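/- Width seat `ym-line-sfw-p2-w5` (prover-ym-line-sfw-p2-w5-g18-0), free hands on planner ym-idea-2 g16's LINE-19 task board (STUB-PLAN-S4b §11)
(crux `AllWindowsColdBox.BoxHighWindowsSU22` = stmt-QuantumFields-24004 / low item 24335, stub S4b): §VarianceAndEnergy of the planner's checked
scratch `l26/S4bHelpers-scratch-v6.lean` (sha16 5e8a8774ad13f146) — the exact ℓ²-row identity and T4″ ⇐ S3a proved, the §11 interfaces typed. -/
import Summits.QuantumFields.YangMills.Theorems.AllWindowsColdBoxBoxHighLineHodgeBootstrap

/-!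
# LINE-19 S4b §11: the ℓ²-row of the gradient kernel is bounded by the VARIANCE — `Σ_p ((hodgeQ⁻¹λ_p)_e)² ≤ (hodgeQ⁻¹)_{ee}` — so T4″ ⇐ S3a

STUB-PLAN-S4b §11 (planner ym-idea-2 g16, 2026-08-29T12:15Z) retires the pointwise gradient decay H4b.1′ from the critical path of S4b:

* **`sum_sq_gradKernel_le_diag`** (PROVED, exact energy identity): for every Landau free edge `e`,
  `Σ_{p ∈ hodgePlaqs H} ((hodgeQ H)⁻¹ λ_p)_e² ≤ ((hodgeQ H)⁻¹)_{e e}` — with `u :=` row `e` of `(hodgeQ)⁻¹`, `((hodgeQ)⁻¹λ_p)_e = λ_p·u` and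
  `Σ_p (λ_p·u)² + Σ_x (g_x·u)² = u·(hodgeQ u) = u_e` (`hodgeQ_mulVec` ✓, `hodgeQ_posDef` ✓);
* **`gradKernelL2_of_varianceBounded : LandauVarianceBounded → GradKernelL2`** (PROVED; no log, no decay input: T4″ of the bootstrap follows from
  S3a alone);
* the §11 interfaces (statements only, OPEN targets): `edgePlaqDist` (ℓ¹ base-point distance edge ↔ plaquette), `GradKernelEnergyDecay`
  (far part of the ℓ²-row `≤ C(1+log H)²/(1+j)²` — replaces H4b.1′), `HodgeCaccioppoli` (discrete Caccioppoli for the sum-of-local-squares `hodgeQ`;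
  S–M), `EnergyDecayAssembly` (`HodgeCaccioppoli → LandauKernelDecay → LandauVarianceBounded → GradKernelEnergyDecay`; S).

Lean text: planner ym-idea-2 g16 (checked scratch, rc 0); this seat modularised it (Mathlib's `dotProduct_sum` instead of a scratch copy) and
re-checked.  HONEST LABEL: helper lemmas + typed statements toward ONE registered stub (S4b) of a critic-PASSed line on the R2ξ″ RECORD-rung crux
24004 / 24335; the Props are OPEN targets, not results; no stub is proved by name, no crux, rung or summit is proved; the Yang–Mills mass gap is
NOT proved by this file.
-/

set_option autoImplicit false

noncomputable section

open Finset Matrix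
open Literature.MathematicalPhysics.QuantumFieldTheory
open Literature.MathematicalPhysics.QuantumFieldTheory.LatticeMaxwell
open Literature.MathematicalPhysics.QuantumFieldTheory.AxialGauge
open Summit.QuantumFields.YangMills.Theorems.WeakCouplingRates
open Summit.QuantumFields.YangMills.Theorems.AllWindowsColdBox
open Literature.Probability.LatticeModels (Site mem_halfOpenBox halfOpenBox)

namespace Summit.QuantumFields.YangMills.Theorems.AllWindowsColdBoxBoxHighLine

/-- **The exact ℓ²-row identity (PROVED):** for every free edge `e`, `Σ_{p ∈ hodgePlaqs H} ((hodgeQ H)⁻¹ λ_p)_e² ≤ ((hodgeQ H)⁻¹)_{e e}`.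
Proof: with `u := row e of (hodgeQ H)⁻¹`, `((hodgeQ)⁻¹ λ_p)_e = u · λ_p`, and `Σ_p (λ_p·u)² + Σ_x (g_x·u)² = u · (hodgeQ u) = (δ_e ᵥ* 1) · u = u_e`. -/
theorem sum_sq_gradKernel_le_diag (H : ℕ) (e : LandauFree H) :
    ∑ p ∈ hodgePlaqs H, (((hodgeQ H)⁻¹ *ᵥ landauCoeff H p) e) ^ 2 ≤ (hodgeQ H)⁻¹ e e := by
  classical
  have hdet : IsUnit (hodgeQ H).det := isUnit_iff_ne_zero.2 (hodgeQ_posDef H).det_pos.ne'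
  obtain ⟨u, hu0⟩ : ∃ u : LandauFree H → ℝ, u = Pi.single e 1 ᵥ* (hodgeQ H)⁻¹ := ⟨_, rfl⟩
  have hu : ∀ e', u e' = (hodgeQ H)⁻¹ e e' := by
    intro e'
    rw [hu0]
    simp [Matrix.vecMul, dotProduct, Pi.single_apply]
  have h1 : ∀ p, ((hodgeQ H)⁻¹ *ᵥ landauCoeff H p) e = landauCoeff H p ⬝ᵥ u := by
    intro p
    simp only [Matrix.mulVec, dotProduct, hu]
    exact Finset.sum_congr rfl fun x _ => mul_comm _ _
  have huQ : u ᵥ* hodgeQ H = Pi.single e 1 := by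
    rw [hu0, Matrix.vecMul_vecMul, Matrix.nonsing_inv_mul _ hdet, Matrix.vecMul_one]
  have henergy : u ⬝ᵥ (hodgeQ H *ᵥ u) = (hodgeQ H)⁻¹ e e := by
    rw [Matrix.dotProduct_mulVec, huQ, ← hu e]
    simp [dotProduct, Pi.single_apply]
  have hA : u ⬝ᵥ (∑ p ∈ hodgePlaqs H, (landauCoeff H p ⬝ᵥ u) • landauCoeff H p) =
      ∑ p ∈ hodgePlaqs H, (landauCoeff H p ⬝ᵥ u) ^ 2 := by
    rw [dotProduct_sum]
    refine Finset.sum_congr rfl fun p _ => ?_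
    rw [dotProduct_smul, smul_eq_mul, dotProduct_comm u, sq]
  have hB : u ⬝ᵥ (∑ x ∈ interiorSites H, (gradVec H x ⬝ᵥ u) • gradVec H x) =
      ∑ x ∈ interiorSites H, (gradVec H x ⬝ᵥ u) ^ 2 := by
    rw [dotProduct_sum]
    refine Finset.sum_congr rfl fun x _ => ?_
    rw [dotProduct_smul, smul_eq_mul, dotProduct_comm u, sq]
  have hexpand : u ⬝ᵥ (hodgeQ H *ᵥ u) =
      (∑ p ∈ hodgePlaqs H, (landauCoeff H p ⬝ᵥ u) ^ 2) + ∑ x ∈ interiorSites H, (gradVec H x ⬝ᵥ u) ^ 2 := by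
    rw [hodgeQ_mulVec, dotProduct_add, hA, hB]
  have hnonneg : 0 ≤ ∑ x ∈ interiorSites H, (gradVec H x ⬝ᵥ u) ^ 2 := Finset.sum_nonneg fun x _ => sq_nonneg _
  calc ∑ p ∈ hodgePlaqs H, (((hodgeQ H)⁻¹ *ᵥ landauCoeff H p) e) ^ 2
      = ∑ p ∈ hodgePlaqs H, (landauCoeff H p ⬝ᵥ u) ^ 2 := Finset.sum_congr rfl fun p _ => by rw [h1]
    _ ≤ (hodgeQ H)⁻¹ e e := by linarith [henergy, hexpand]

/-- **T4″ from S3a — PROVED, no log, no decay input:** `GradKernelL2 ⇐ LandauVarianceBounded`. -/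
theorem gradKernelL2_of_varianceBounded (h : LandauVarianceBounded) : GradKernelL2 := by
  obtain ⟨C, hC⟩ := h
  refine ⟨max C 0, fun H hH e => ?_⟩
  have hlog : 0 ≤ Real.log (H : ℝ) := Real.log_nonneg (by exact_mod_cast hH)
  have h1 : (1 : ℝ) ≤ (1 + Real.log H) ^ 2 := by nlinarith
  calc ∑ p ∈ hodgePlaqs H, (((hodgeQ H)⁻¹ *ᵥ landauCoeff H p) e) ^ 2 ≤ (hodgeQ H)⁻¹ e e := sum_sq_gradKernel_le_diag H e
    _ ≤ max C 0 := (hC H hH e).trans (le_max_left _ _)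
    _ = max C 0 * 1 := (mul_one _).symm
    _ ≤ max C 0 * (1 + Real.log H) ^ 2 := mul_le_mul_of_nonneg_left h1 (le_max_right _ _)

/-! ## §11 interfaces (statements; OPEN targets) -/

/-- ℓ¹ distance from the base point of a free edge to the base point of a plaquette (the convention of H4b.1′/H4b.1″). -/
def edgePlaqDist {H : ℕ} (e : LandauFree H) (p : Plaq 4) : ℤ := ∑ m : Fin 4, |e.1.1.1 m - p.1 m|

/-- **Energy decay of the gradient kernel (replaces H4b.1′; follows from S3 = S3a ∧ S3b by a discrete Caccioppoli inequality for `hodgeQ`, which is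
a sum of squares of local linear functionals — STUB-PLAN-S4b §11):** the far part of the ℓ²-row decays like `r⁻²` (one Green's-function derivative
in four dimensions, squared and summed outside a ball), with the `(1+log H)²` of S3b. -/
def GradKernelEnergyDecay : Prop :=
  ∃ C : ℝ, ∀ H : ℕ, 1 ≤ H → ∀ e : LandauFree H, ∀ j : ℕ,
    ∑ p ∈ (hodgePlaqs H).filter (fun p => (j : ℤ) ≤ edgePlaqDist e p), (((hodgeQ H)⁻¹ *ᵥ landauCoeff H p) e) ^ 2 ≤
      C * (1 + Real.log H) ^ 2 / (1 + (j : ℝ)) ^ 2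

/-- The discrete Caccioppoli inequality for `hodgeQ` (S–M; pure algebra of a sum of local squares + a cutoff at scale `r`): the curl-energy of the
column `u = (hodgeQ H)⁻¹ δ_e` outside the ℓ¹-ball of radius `2r` around `e` is at most `C r⁻²` times the ℓ²-mass of `u` on the annulus `r ≤ d < 2r + 4`. -/
def HodgeCaccioppoli : Prop :=
  ∃ C : ℝ, ∀ H : ℕ, 1 ≤ H → ∀ e : LandauFree H, ∀ r : ℕ, 1 ≤ r →
    ∑ p ∈ (hodgePlaqs H).filter (fun p => 2 * (r : ℤ) ≤ edgePlaqDist e p), (((hodgeQ H)⁻¹ *ᵥ landauCoeff H p) e) ^ 2 ≤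
      C / (r : ℝ) ^ 2 * ∑ e' ∈ (Finset.univ : Finset (LandauFree H)).filter
        (fun e' => (r : ℤ) ≤ ∑ m : Fin 4, |e.1.1.1 m - e'.1.1.1 m| ∧ ∑ m : Fin 4, |e.1.1.1 m - e'.1.1.1 m| < 2 * r + 4), ((hodgeQ H)⁻¹ e e') ^ 2

/-- The bookkeeping implication (S; counting as in `plaquetteShellSum`): Caccioppoli + S3b (pointwise `|u| ≤ C(1+log H)(1+d)⁻²` on the annulus,
`#annulus ≲ r⁴`) + S3a (the near part `j ≤ 2`) ⇒ `GradKernelEnergyDecay`. -/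
def EnergyDecayAssembly : Prop :=
  HodgeCaccioppoli → LandauKernelDecay → LandauVarianceBounded → GradKernelEnergyDecay

end Summit.QuantumFields.YangMills.Theorems.AllWindowsColdBoxBoxHighLine

end
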